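import Summits.Langlands.Langlands.Theorems.PicardMuOrdinaryMuOrdinaryFamilyRTPointPlan
import Summits.Langlands.Langlands.Theorems.PicardMuOrdinaryMuOrdinaryFamilyRTEndgame
import Summits.Langlands.Langlands.Theorems.PicardMuOrdinaryResidualAutomorphyEvenQuarticDisc

/-!
# The Picard point of line `free-seed-smooth-rt` (crux `MuOrdinaryFamilyRT`, stmt-Langlands-13757):
# the four roots of `f` in `K̄`, their integral multiples modulo a good prime, and LEAF `rbarUnramified`

Helper file for the registered stub `stub_point` (plan: `…PointPlan.lean`).  For a generic quartic
`f ∈ ℤ[X]` (`Generic f`: degree `4`, separable) we PROVE, unconditionally: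

* `card_roots`, `rootEnum` — `Roots f` (the roots of `f` in `K̄`) has four elements, enumerated by
  `rootEnum : Fin 4 ≃ Roots f`; `map_eq_splitQuartic` — `f = lc(f) ∏ᵢ (X - αᵢ)` over `K̄`;
  `cast_discr_eq` — `disc(f) = lc(f)⁶ (∏_{i<j} (αⱼ - αᵢ))²` in `K̄` (Mathlib's `Polynomial.discr`, via
  the route's `discr_splitQuartic` and `discr_map_of_injective`);
* `yInt α = lc(f) · α ∈ \bar ℤ_K` (`absIntegers (𝓞 K) K`), `smul_yInt` (`σ • y_α = y_{σα}`),
  `prod_yInt_sub_sq` (`(∏_{i<j} (y_j - y_i))² = lc(f)⁶ disc(f)`), and **`yInt_sub_notMem`**: for a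
  place `v ∉ S(f)` (`v ∤ 3 · disc f · lc f`) and a prime `𝔓 ∣ v` of `\bar ℤ_K`, the `y_α` are
  pairwise distinct modulo `𝔓`;
* `rbar_eq_one_of_forall_smul_eq` and **`theorem rbarUnramified : Leaf.rbarUnramified`** — the heart
  `r̄_f^B` is unramified outside `S(f)`: an element of the inertia group `I_𝔓` moves `y_α` to
  `y_{σα} ≡ y_α (mod 𝔓)`, hence fixes every root.
-/

-- `Summit.Langlands.Langlands.…` (summit = sub-problem name, D-0017 layout) trips `dupNamespace` on every decl.
set_option linter.dupNamespace false

namespace Summit.Langlands.Langlands.Cruxes.MuOrdinaryFamilyRT.FreeSeedSmoothRt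

open scoped NumberField Polynomial Matrix Classical
open Field IsDedekindDomain Polynomial Finset
open Literature.NumberTheory.GaloisRepresentations
open Summit.Langlands.Langlands.Theorems.ResidualAutomorphyEven (splitQuartic prodFour discr_splitQuartic
  discr_map_of_injective roots_splitQuartic leadingCoeff_splitQuartic prod_Ioi_four)

noncomputable section

/-! ### The four roots of `f` in `K̄` -/

section Roots

variable (f : ℤ[X])

/-- `(f ↦ K ↦ K̄) = (f ↦ K̄)`. -/
theorem map_map_algebraMap :
    (f.map (algebraMap ℤ K)).map (algebraMap K (AlgebraicClosure K)) = f.map (algebraMap ℤ (AlgebraicClosure K)) := by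
  rw [Polynomial.map_map, ← IsScalarTower.algebraMap_eq]

/-- A root `α ∈ Roots f` is a root of `f`. -/
theorem aeval_coe_roots (α : Roots f) : aeval (α : AlgebraicClosure K) f = 0 := by
  have h := (mem_rootSet.mp α.2).2
  rwa [aeval_map_algebraMap] at h

variable {f} (hgen : Generic f)
include hgen

/-- `f ≠ 0`. -/
theorem ne_zero_of_generic : f ≠ 0 := by
  rintro rfl
  exact absurd hgen.1 (by simp)

/-- `lc(f) ≠ 0` in `K̄`. -/
theorem leadingCoeff_cast_ne_zero : ((f.leadingCoeff : ℤ) : AlgebraicClosure K) ≠ 0 := by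
  rw [Ne, Int.cast_eq_zero, leadingCoeff_eq_zero]
  exact ne_zero_of_generic hgen

/-- `f` is separable over `K̄`. -/
theorem separable_map_algebraicClosure : (f.map (algebraMap ℤ (AlgebraicClosure K))).Separable := by
  have h := hgen.2.1.map (f := algebraMap ℚ (AlgebraicClosure K))
  rwa [Polynomial.map_map, RingHom.ext_int ((algebraMap ℚ (AlgebraicClosure K)).comp (Int.castRingHom ℚ))
    (algebraMap ℤ (AlgebraicClosure K))] at h

/-- `f` (over `K`) is separable. -/
theorem separable_map_K : (f.map (algebraMap ℤ K)).Separable := by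
  have h := hgen.2.1.map (f := algebraMap ℚ K)
  rwa [Polynomial.map_map, RingHom.ext_int ((algebraMap ℚ K).comp (Int.castRingHom ℚ)) (algebraMap ℤ K)] at h

/-- `#Roots f = 4`. -/
theorem card_roots : Fintype.card (Roots f) = 4 := by
  rw [card_rootSet_eq_natDegree (separable_map_K hgen) (IsAlgClosed.splits _),
    natDegree_map_eq_of_injective (algebraMap ℤ K).injective_int, hgen.1]

/-- An enumeration of the four roots. -/
def rootEnum : Fin 4 ≃ Roots f := (Fintype.equivFinOfCardEq (card_roots hgen)).symm

/-- **`f = lc(f) ∏ (X - αᵢ)` over `K̄`.** -/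
theorem map_eq_splitQuartic :
    f.map (algebraMap ℤ (AlgebraicClosure K)) =
      splitQuartic ((f.leadingCoeff : ℤ) : AlgebraicClosure K) (fun i => ((rootEnum hgen i : Roots f) : AlgebraicClosure K)) := by
  set g := f.map (algebraMap ℤ (AlgebraicClosure K)) with hg
  have hsplit : g.Splits := IsAlgClosed.splits g
  have hg0 : g ≠ 0 := (Polynomial.map_ne_zero_iff (algebraMap ℤ (AlgebraicClosure K)).injective_int).mpr
    (ne_zero_of_generic hgen)
  have hlc : g.leadingCoeff = ((f.leadingCoeff : ℤ) : AlgebraicClosure K) := by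
    rw [hg, leadingCoeff_map_of_injective (algebraMap ℤ (AlgebraicClosure K)).injective_int, eq_intCast]
  have hsep : g.Separable := separable_map_algebraicClosure hgen
  -- the roots of `g` are the `rootEnum i`
  have hroots : g.roots = (univ : Finset (Fin 4)).val.map fun i => ((rootEnum hgen i : Roots f) : AlgebraicClosure K) := by
    apply (Multiset.Nodup.ext (nodup_roots hsep) ?_).mpr
    · intro a
      rw [Multiset.mem_map, mem_roots hg0]
      constructor
      · intro ha
        have hmem : a ∈ (f.map (algebraMap ℤ K)).rootSet (AlgebraicClosure K) := by
          rw [mem_rootSet]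
          refine ⟨(Polynomial.map_ne_zero_iff (algebraMap ℤ K).injective_int).mpr (ne_zero_of_generic hgen), ?_⟩
          rw [aeval_map_algebraMap, aeval_def, ← eval_map, ← hg]
          exact ha
        refine ⟨(rootEnum hgen).symm ⟨a, hmem⟩, Finset.mem_univ_val _, ?_⟩
        rw [Equiv.apply_symm_apply]
      · rintro ⟨i, -, rfl⟩
        have h := (mem_rootSet.mp (rootEnum hgen i).2).2
        rw [IsRoot.def, hg, eval_map, ← aeval_def]
        rwa [aeval_map_algebraMap] at h
    · exact (Multiset.nodup_map_iff_of_injective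
        (Subtype.coe_injective.comp (rootEnum hgen).injective)).mpr (Finset.univ : Finset (Fin 4)).nodup
  have hcard : Multiset.card g.roots = g.natDegree := (splits_iff_card_roots.mp hsplit)
  rw [← C_leadingCoeff_mul_prod_multiset_X_sub_C hcard, hlc, hroots, splitQuartic,
    Summit.Langlands.Langlands.Theorems.ResidualAutomorphyEven.prodFour_eq_multiset_prod]

/-- **`disc(f) = lc(f)⁶ (∏_{i<j} (αⱼ - αᵢ))²` in `K̄`.** -/
theorem cast_discr_eq :
    ((f.discr : ℤ) : AlgebraicClosure K) =
      ((f.leadingCoeff : ℤ) : AlgebraicClosure K) ^ 6 *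
        (∏ i : Fin 4, ∏ j ∈ Ioi i, (((rootEnum hgen j : Roots f) : AlgebraicClosure K) - (rootEnum hgen i : Roots f))) ^ 2 := by
  have hdeg : 0 < f.degree := by
    rw [degree_eq_natDegree (ne_zero_of_generic hgen), hgen.1]; norm_num
  have h := discr_map_of_injective (algebraMap ℤ (AlgebraicClosure K)) (algebraMap ℤ (AlgebraicClosure K)).injective_int f hdeg
  rw [map_eq_splitQuartic hgen, discr_splitQuartic _ (leadingCoeff_cast_ne_zero hgen), eq_intCast] at h
  exact h.symm

/-! ### The algebraic integers `y_α = lc(f) · α` and their reductions -/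

omit hgen in
/-- `lc(f) · α` is an algebraic integer for every root `α`. -/
theorem isIntegral_leadingCoeff_mul (α : Roots f) :
    IsIntegral (𝓞 K) (((f.leadingCoeff : ℤ) : AlgebraicClosure K) * (α : AlgebraicClosure K)) := by
  have h := isIntegral_leadingCoeff_smul f (α : AlgebraicClosure K) (aeval_coe_roots f α)
  rw [Algebra.smul_def, eq_intCast] at h
  obtain ⟨p, hp, hpx⟩ := h
  refine ⟨p.map (Int.castRingHom (𝓞 K)), hp.map _, ?_⟩
  rwa [eval₂_map, RingHom.ext_int ((algebraMap (𝓞 K) (AlgebraicClosure K)).comp (Int.castRingHom (𝓞 K)))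
    (algebraMap ℤ (AlgebraicClosure K))]

omit hgen in
/-- `y_α = lc(f) · α ∈ \bar ℤ_K`. -/
def yInt (α : Roots f) : absIntegers (𝓞 K) K :=
  ⟨((f.leadingCoeff : ℤ) : AlgebraicClosure K) * (α : AlgebraicClosure K), isIntegral_leadingCoeff_mul α⟩

omit hgen in
/-- `y_α` in `K̄`. -/
@[simp] theorem coe_yInt (α : Roots f) :
    ((yInt α : absIntegers (𝓞 K) K) : AlgebraicClosure K) = ((f.leadingCoeff : ℤ) : AlgebraicClosure K) * α := rfl

omit hgen in
/-- `Γ_K` permutes the `y_α` like the roots: `σ • y_α = y_{σ α}`. -/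
theorem smul_yInt (σ : absoluteGaloisGroup K) (α : Roots f) : σ • yInt α = yInt (σ • α) := by
  apply Subtype.ext
  rw [integralClosure.coe_smul, coe_yInt, coe_yInt, rootSet.coe_smul, smul_mul', absoluteGaloisGroup.smul_def,
    absoluteGaloisGroup.smul_def, map_intCast]

/-- **`(∏_{i<j} (y_j - y_i))² = lc(f)⁶ · disc(f)` in `\bar ℤ_K`.** -/
theorem prod_yInt_sub_sq :
    (∏ i : Fin 4, ∏ j ∈ Ioi i, (yInt (rootEnum hgen j) - yInt (rootEnum hgen i))) ^ 2 =
      algebraMap ℤ (absIntegers (𝓞 K) K) (f.leadingCoeff ^ 6 * f.discr) := by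
  have hc := cast_discr_eq hgen
  rw [prod_Ioi_four] at hc ⊢
  apply Subtype.ext
  rw [eq_intCast]
  push_cast [coe_yInt]
  rw [hc]
  ring

/-- **Distinct roots stay distinct modulo a good prime**: for `v ∉ S(f)` and `𝔓 ∣ v`,
`y_β - y_α ∉ 𝔓` whenever `α ≠ β`. -/
theorem yInt_sub_notMem {v : HeightOneSpectrum (𝓞 K)} (hv : v ∉ badPrimes f)
    {𝔓 : Ideal (absIntegers (𝓞 K) K)} (h𝔓 : 𝔓 ∈ v.primesAbove) {α β : Roots f} (hne : α ≠ β) :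
    yInt β - yInt α ∉ 𝔓 := by
  haveI : 𝔓.IsPrime := h𝔓.1
  intro hmem
  -- `y_β - y_α` divides `D = ∏_{i<j} (y_j - y_i)` up to sign, so `D ∈ 𝔓`
  set e := rootEnum hgen with he
  set D := ∏ i : Fin 4, ∏ j ∈ Ioi i, (yInt (e j) - yInt (e i)) with hD
  have hdvd : ∀ i j : Fin 4, i < j → (yInt (e j) - yInt (e i)) ∣ D := fun i j hij =>
    (Finset.dvd_prod_of_mem (fun j => yInt (e j) - yInt (e i)) (Finset.mem_Ioi.mpr hij)).trans
      (Finset.dvd_prod_of_mem (fun i => ∏ j ∈ Ioi i, (yInt (e j) - yInt (e i))) (Finset.mem_univ i))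
  have hDmem : D ∈ 𝔓 := by
    set i := e.symm α
    set j := e.symm β
    have hi : e i = α := e.apply_symm_apply α
    have hj : e j = β := e.apply_symm_apply β
    have hij : i ≠ j := fun h => hne (by rw [← hi, ← hj, h])
    rcases lt_or_gt_of_ne hij with h | h
    · obtain ⟨c, hc⟩ := hdvd i j h
      rw [hi, hj] at hc
      rw [hc]
      exact 𝔓.mul_mem_right c hmem
    · obtain ⟨c, hc⟩ := hdvd j i h
      rw [hi, hj] at hc
      rw [hc]
      refine 𝔓.mul_mem_right c ?_
      rw [← neg_sub]
      exact 𝔓.neg_mem hmem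
  -- hence `lc^6 disc f ∈ 𝔓 ∩ 𝓞 K = v`
  have hsq : algebraMap ℤ (absIntegers (𝓞 K) K) (f.leadingCoeff ^ 6 * f.discr) ∈ 𝔓 := by
    rw [← prod_yInt_sub_sq hgen, pow_two]
    exact 𝔓.mul_mem_left D hDmem
  have hv' : ((f.leadingCoeff ^ 6 * f.discr : ℤ) : 𝓞 K) ∈ v.asIdeal := by
    rw [h𝔓.2.over, Ideal.mem_under, map_intCast]
    rwa [eq_intCast] at hsq
  -- so `v ∈ S(f)`
  apply hv
  change ((3 * f.discr * f.leadingCoeff : ℤ) : 𝓞 K) ∈ v.asIdeal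
  rw [Int.cast_mul, Int.cast_pow] at hv'
  rcases v.isPrime.mem_or_mem hv' with h | h
  · have hlc := v.isPrime.mem_of_pow_mem 6 h
    rw [Int.cast_mul]
    exact v.asIdeal.mul_mem_left _ hlc
  · rw [Int.cast_mul, Int.cast_mul]
    exact v.asIdeal.mul_mem_right _ (v.asIdeal.mul_mem_left _ h)

end Roots

/-! ### LEAF `rbarUnramified` -/

/-- An element of `Γ_K` fixing every root acts trivially on the heart. -/
theorem rbar_eq_one_of_forall_smul_eq (f : ℤ[X]) (B : Module.Basis (Fin 3) (ZMod 3) (Heart 3 (Roots f)))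
    (σ : absoluteGaloisGroup K) (hσ : ∀ α : Roots f, σ • α = α) : rbar f B σ = 1 := by
  have hperm : permRep (ZMod 3) (absoluteGaloisGroup K) (Roots f) σ = LinearMap.id := by
    refine Finsupp.lhom_ext' fun α => LinearMap.ext_ring ?_
    rw [LinearMap.comp_apply, Finsupp.lsingle_apply, permRep_single, LinearMap.comp_apply,
      LinearMap.id_apply, Finsupp.lsingle_apply, hσ α]
  have haug : augmentationRep (ZMod 3) (absoluteGaloisGroup K) (Roots f) σ = LinearMap.id := by
    refine LinearMap.ext fun x => Subtype.ext ?_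
    rw [coe_augmentationRep_apply, hperm]
    rfl
  have hheart : heartRep 3 (Roots f) (absoluteGaloisGroup K) σ = LinearMap.id := by
    refine LinearMap.ext fun x => ?_
    obtain ⟨x, rfl⟩ := Submodule.Quotient.mk_surjective _ x
    rw [heartRep_mk, haug]
    rfl
  rw [rbar, MonoidHom.comp_apply]
  change Units.map _ ((heartRep 3 (Roots f) (absoluteGaloisGroup K)).asGroupHom σ) = 1
  have : (heartRep 3 (Roots f) (absoluteGaloisGroup K)).asGroupHom σ = 1 := by
    refine Units.ext ?_
    rw [Representation.asGroupHom_apply, hheart]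
    rfl
  rw [this, map_one]

/-- **LEAF `rbarUnramified`**: for generic `f` the heart `r̄_f^B` is unramified outside `S(f)`
(an element of an inertia group at `𝔓 ∣ v`, `v ∉ S(f)`, moves `y_α` to `y_{σα} ≡ y_α (mod 𝔓)`, and
the `y`'s are pairwise distinct modulo `𝔓`, so it fixes every root). -/
theorem rbarUnramified : Leaf.rbarUnramified := by
  intro f B hgen v hv 𝔓 h𝔓 σ hσ
  refine rbar_eq_one_of_forall_smul_eq f B σ fun α => ?_
  by_contra hne
  have hmem : σ • yInt α - yInt α ∈ 𝔓 := hσ (yInt α)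
  rw [smul_yInt] at hmem
  exact yInt_sub_notMem hgen hv h𝔓 (Ne.symm hne) hmem

end

end Summit.Langlands.Langlands.Cruxes.MuOrdinaryFamilyRT.FreeSeedSmoothRt
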